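import Summits.QuantumFields.BalabanUV.Beta.EriceFlowEnclosureBorelShiftedRays
import Summits.QuantumFields.BalabanUV.Beta.EriceFlowEnclosureBorelDirectional

/-!
# Beta / EriceFlowEnclosureBorelPathMove — THE PATH `γ_b` OF NEVANLINNA'S CONVERSE: for `B` holomorphic on
# `ball 0 R₀ ∪ {Re τ > 0, |Im τ| < η}` (`η < R₀`) with `‖B τ‖ ≤ A·e^{c·Re τ}` on the half-strip, the Laplace integral `∫₀^∞ e^{−tw}B(t)dt`
# (`Re w > c`) EQUALS the integral along the segment `[0, η·d_ε]`, `d_ε = (3 − 4εi)∕5` (`ε = ±1`), followed by the horizontal ray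
# `η·d_ε + ℝ₊` — Cauchy in the convex set `{Re ζ > −R₀∕10, |Im ζ| < 9η∕10} ⊂ ball ∪ strip` (37a), the far connector being
# exponentially small — and the horizontal ray is FLAT: `≤ A e^{cη} e^{−Re(η d_ε w)}∕(Re w − c)` ([LodayRichaud2016] Thm 5.3.9 (i)⇒(ii), `|g^b(x)| ≤ K e^{A|b^k|} e^{−Re(b^k∕x^k)}∫₀^{+∞}e^{−(Re(1∕x^k)−A)τ}dτ`)
# (bflow-p3 gen 39 ∕ 40, MODULE 37c over 37a ∕ 35a; Mathlib + tree only)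

HONEST FRAMING (page 1 of everything the β sub-cell writes): discharging `BetaPertH` makes Bałaban's UV stability UNCONDITIONAL — a
real constructive-QFT result; it is NOT the continuum limit and NOT the Clay problem.  HONEST DEPENDENCY (cell reorg 2026-08-19,
verbatim): «continuum YM on T⁴ ⇐ BetaPertH ∧ nine spine estimates (0/9 proved); BetaPertH ⇐ (D1) ∧ (D4) ∧ CAP+tail; G-an2-4 gates
asym, D1 and NE2/3/4.»  THIS MODULE DISCHARGES NOTHING: [folklore] one-variable complex analysis over Mathlib (no β-function, no
flow, no Erice sentence is used).

SOURCE (shapes only).  [LodayRichaud2016] Thm 5.3.9 p. 156, (i)⇒(ii) proof pp. 157–158 (path `γ_b`: «from Cauchy's theorem we can integrate as well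
on a path γ_b homotopic to [0, +∞[ … made of a straight line from 0 to b^k and … a horizontal line from b^k to +∞»; `g^b`
exponentially flat: «Prove that g^b(x) is k-exponentially flat»); [Rivasseau1991] Thm I.5.1 «reciprocal» pp. 55–56.

THE POINT.  On `ε·Im w ≥ Re w > c` the real-direction estimate of 34i is `N!‖w‖∕(Re w − c)^{N+1}` — useless as `|Im w| → ∞`; along
`d = d_ε` instead `Re(d·w) ≥ (2∕5)‖w‖` (`‖w‖ ≤ Re w + ε·Im w`).  The corner `b = η·d` has `Re b = 3η∕5 > 0`, `|Im b| = 4η∕5 < η`,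
`‖b‖ = η < R₀`: the segment lies in the ball, the horizontal ray in the strip, both in the convex region `U′`.

WHAT THIS FILE PROVES (0 sorry, 0 def).  §1 the direction: `dir_re`, `dir_im`, `norm_dir`, `dir_ne_zero`, `re_dir_mul`, `re_dir_mul_ge`.
§2 the corner and the region: `corner_re`, `abs_corner_im`, `norm_corner`, `isOpen_region`, `convex_region`, `region_subset`,
`segment_rescale` (`∫₀¹ h(σ·ηd)ηd dσ = ∫₀^η h(sd)d ds`).  §3 `integrableOn_laplace_real` (35a with `d = 1`), **`hray_estimate`** (the shifted
horizontal ray: integrable, `‖∫₀^∞e^{−(b+s)w}B(b+s)ds‖ ≤ A e^{cη}e^{−Re(bw)}∕(Re w − c)`).  §4 HEADLINE **`laplace_eq_segment_add_hray`**: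
`∫₀^∞ e^{−tw}B(t)dt = ∫₀^η e^{−s(dw)}B(sd)·d ds + ∫₀^∞ e^{−(b+s)w}B(b+s)ds` for `Re w > c`, `Re(bw) ≥ 0`.
NOT CLAIMED: the Gevrey estimate itself (37d), anything about Erice's β; `BetaPertH`, continuum, Clay.
-/

namespace Summit.QuantumFields.BalabanUV.Beta.EriceFlowEnclosureBorelPathMove

open Set Filter Topology MeasureTheory Metric Complex
open scoped Real Nat
open Summit.QuantumFields.BalabanUV.Beta.EriceFlowEnclosureBorelShiftedRays (integral_Ioi_sub_integral_Ioi_shift)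
open Summit.QuantumFields.BalabanUV.Beta.EriceFlowEnclosureBorelDirectional (integrableOn_laplace_directional)

noncomputable section

/-! ## §1 The direction `d_ε = (3 − 4εi)∕5` -/

/-- `Re d_ε = 3∕5`. [folklore] -/
theorem dir_re (ε : ℝ) : (((3 : ℂ) - 4 * (ε : ℂ) * I) / 5).re = 3 / 5 := by
  simp

/-- `Im d_ε = −4ε∕5`. [folklore] -/
theorem dir_im (ε : ℝ) : (((3 : ℂ) - 4 * (ε : ℂ) * I) / 5).im = -(4 * ε) / 5 := by
  simp

/-- `‖d_ε‖ = 1` for `ε = ±1`. [folklore] -/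
theorem norm_dir {ε : ℝ} (hε : ε = 1 ∨ ε = -1) : ‖((3 : ℂ) - 4 * (ε : ℂ) * I) / 5‖ = 1 := by
  have hε2 : ε ^ 2 = 1 := by rcases hε with h | h <;> rw [h] <;> norm_num
  have h : ‖((3 : ℂ) - 4 * (ε : ℂ) * I) / 5‖ ^ 2 = 1 := by
    rw [Complex.sq_norm, Complex.normSq_apply, dir_re, dir_im]; nlinarith [hε2]
  have hn : 0 ≤ ‖((3 : ℂ) - 4 * (ε : ℂ) * I) / 5‖ := norm_nonneg _
  nlinarith [h, hn]

/-- `d_ε ≠ 0`. [folklore] -/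
theorem dir_ne_zero (ε : ℝ) : ((3 : ℂ) - 4 * (ε : ℂ) * I) / 5 ≠ 0 := by
  intro h
  have := congrArg Complex.re h
  rw [dir_re, Complex.zero_re] at this
  norm_num at this

/-- `Re(d_ε·w) = (3·Re w + 4ε·Im w)∕5`. [folklore] -/
theorem re_dir_mul (ε : ℝ) (w : ℂ) : (((3 : ℂ) - 4 * (ε : ℂ) * I) / 5 * w).re = (3 * w.re + 4 * ε * w.im) / 5 := by
  rw [Complex.mul_re, dir_re, dir_im]; ring

/-- On the region `ε·Im w ≥ Re w ≥ 0` (`ε = ±1`): `Re(d_ε·w) ≥ (2∕5)‖w‖` (`‖w‖ ≤ |Re w| + |Im w| = Re w + ε·Im w ≤ 2ε·Im w`). [folklore] -/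
theorem re_dir_mul_ge {ε : ℝ} (hε : ε = 1 ∨ ε = -1) {w : ℂ} (hre : 0 ≤ w.re) (hreg : w.re ≤ ε * w.im) :
    2 / 5 * ‖w‖ ≤ (((3 : ℂ) - 4 * (ε : ℂ) * I) / 5 * w).re := by
  rw [re_dir_mul]
  have habs : |w.im| = ε * w.im := by
    rcases hε with h | h
    · rw [h, one_mul]; exact abs_of_nonneg (by rw [h, one_mul] at hreg; linarith)
    · rw [h, neg_one_mul]; exact abs_of_nonpos (by rw [h] at hreg; linarith)
  have hn : ‖w‖ ≤ w.re + ε * w.im := by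
    have := Complex.norm_le_abs_re_add_abs_im w
    rwa [abs_of_nonneg hre, habs] at this
  linarith

/-! ## §2 The corner `b = η·d_ε` and the convex region `U′ = {Re ζ > −R₀∕10, |Im ζ| < 9η∕10}` -/

/-- `Re(η·d_ε) = 3η∕5`. [folklore] -/
theorem corner_re (ε η : ℝ) : ((η : ℂ) * (((3 : ℂ) - 4 * (ε : ℂ) * I) / 5)).re = 3 * η / 5 := by
  rw [Complex.re_ofReal_mul, dir_re]; ring

/-- `|Im(η·d_ε)| = 4η∕5` for `ε = ±1`, `η ≥ 0`. [folklore] -/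
theorem abs_corner_im {ε η : ℝ} (hε : ε = 1 ∨ ε = -1) (hη : 0 ≤ η) :
    |((η : ℂ) * (((3 : ℂ) - 4 * (ε : ℂ) * I) / 5)).im| = 4 * η / 5 := by
  have habsε : |ε| = 1 := by rcases hε with h | h <;> rw [h] <;> norm_num
  rw [Complex.im_ofReal_mul, dir_im, abs_mul, abs_of_nonneg hη, abs_div, abs_neg, abs_mul, habsε]
  norm_num; ring

/-- `‖η·d_ε‖ = η` for `ε = ±1`, `η ≥ 0`. [folklore] -/
theorem norm_corner {ε η : ℝ} (hε : ε = 1 ∨ ε = -1) (hη : 0 ≤ η) :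
    ‖(η : ℂ) * (((3 : ℂ) - 4 * (ε : ℂ) * I) / 5)‖ = η := by
  rw [norm_mul, Complex.norm_real, Real.norm_of_nonneg hη, norm_dir hε, mul_one]

/-- The region `U′` is open. [folklore] -/
theorem isOpen_region (R₀ η : ℝ) : IsOpen {ζ : ℂ | -(R₀ / 10) < ζ.re ∧ |ζ.im| < 9 * η / 10} :=
  (isOpen_lt continuous_const Complex.continuous_re).inter
    (isOpen_lt (continuous_abs.comp Complex.continuous_im) continuous_const)

/-- The region `U′` is convex (three half-planes). [folklore] -/
theorem convex_region (R₀ η : ℝ) : Convex ℝ {ζ : ℂ | -(R₀ / 10) < ζ.re ∧ |ζ.im| < 9 * η / 10} := by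
  have hl1 : IsLinearMap ℝ fun w : ℂ => w.re := ⟨fun x y => by simp, fun c x => by simp⟩
  have hl2 : IsLinearMap ℝ fun w : ℂ => w.im := ⟨fun x y => by simp, fun c x => by simp⟩
  have e : {ζ : ℂ | -(R₀ / 10) < ζ.re ∧ |ζ.im| < 9 * η / 10} =
      {ζ : ℂ | -(R₀ / 10) < ζ.re} ∩ ({ζ : ℂ | ζ.im < 9 * η / 10} ∩ {ζ : ℂ | -(9 * η / 10) < ζ.im}) := by
    ext ζ; simp only [Set.mem_setOf_eq, Set.mem_inter_iff, abs_lt]; tauto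
  rw [e]
  exact (convex_halfSpace_gt hl1 _).inter ((convex_halfSpace_lt hl2 _).inter (convex_halfSpace_gt hl2 _))

/-- `U′ ⊂ ball 0 R₀ ∪ half-strip` when `0 < η < R₀`: a point of `U′` with `Re ζ ≤ 0` has `‖ζ‖ ≤ |Re ζ| + |Im ζ| < R₀∕10 + 9R₀∕10`.
[folklore] -/
theorem region_subset {R₀ η : ℝ} (hηR : η < R₀) :
    {ζ : ℂ | -(R₀ / 10) < ζ.re ∧ |ζ.im| < 9 * η / 10} ⊆ ball (0 : ℂ) R₀ ∪ {τ : ℂ | 0 < τ.re ∧ |τ.im| < η} := by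
  intro ζ hζ
  have hζ1 : -(R₀ / 10) < ζ.re := hζ.1
  have hζ2 : |ζ.im| < 9 * η / 10 := hζ.2
  rcases lt_or_ge 0 ζ.re with h | h
  · right
    refine ⟨h, hζ2.trans ?_⟩
    have : 0 < η := by
      have := (abs_nonneg ζ.im).trans_lt hζ2; linarith
    linarith
  · left
    rw [mem_ball_zero_iff]
    have h1 : |ζ.re| < R₀ / 10 := by rw [abs_of_nonpos h]; linarith
    have h2 : |ζ.im| < 9 * R₀ / 10 := hζ2.trans_le (by linarith)
    calc ‖ζ‖ ≤ |ζ.re| + |ζ.im| := Complex.norm_le_abs_re_add_abs_im ζ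
      _ < R₀ / 10 + 9 * R₀ / 10 := add_lt_add h1 h2
      _ = R₀ := by ring

/-- **Rescaling the corner segment**: `∫₀¹ h(σ·ηd)·ηd dσ = ∫₀^η h(s·d)·d ds` (substitution `s = ησ`). [folklore] -/
theorem segment_rescale (h : ℂ → ℂ) (d : ℂ) (η : ℝ) :
    ∫ σ in (0 : ℝ)..1, h ((σ : ℂ) * ((η : ℂ) * d)) * ((η : ℂ) * d) = ∫ s in (0 : ℝ)..η, h ((s : ℂ) * d) * d := by
  have e : ∀ σ : ℝ, h ((σ : ℂ) * ((η : ℂ) * d)) * ((η : ℂ) * d) = (η : ℂ) * (h ((η : ℂ) * (σ : ℂ) * d) * d) := by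
    intro σ
    rw [show (σ : ℂ) * ((η : ℂ) * d) = (η : ℂ) * (σ : ℂ) * d by ring]; ring
  have key := intervalIntegral.smul_integral_comp_mul_left (f := fun s : ℝ => h ((s : ℂ) * d) * d) (a := 0) (b := 1) η
  simp only [mul_zero, mul_one, Complex.ofReal_mul] at key
  simp_rw [e]
  rw [intervalIntegral.integral_const_mul, ← Complex.real_smul]
  exact key

/-! ## §3 The two Laplace rays: the real one (integrability) and the shifted horizontal one (flat) -/

/-- Integrability of `t ↦ e^{−tw}B(t)` on `(0,∞)` for `Re w > c` from the strip data alone (35a with `d = 1`). [folklore] -/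
theorem integrableOn_laplace_real {B : ℂ → ℂ} {η A c : ℝ} {w : ℂ} (hη : 0 < η)
    (hBc : ContinuousOn B {τ : ℂ | 0 < τ.re ∧ |τ.im| < η})
    (hBg : ∀ τ : ℂ, 0 < τ.re → |τ.im| < η → ‖B τ‖ ≤ A * Real.exp (c * τ.re)) (hw : c < w.re) :
    IntegrableOn (fun t : ℝ => cexp (-(t : ℂ) * w) * B t) (Ioi 0) := by
  have hBc₁ : ContinuousOn (fun t : ℝ => B ((t : ℂ) * 1)) (Ioi 0) := by
    refine hBc.comp (by fun_prop) fun t ht => ⟨?_, ?_⟩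
    · have ht : (0 : ℝ) < t := ht
      simpa using ht
    · simpa using hη
  have hBg₁ : ∀ t : ℝ, 0 < t → ‖B ((t : ℂ) * 1)‖ ≤ A * Real.exp (c * (t * ‖(1 : ℂ)‖)) := by
    intro t ht
    have h := hBg (t : ℂ) (by simpa using ht) (by simpa using hη)
    simpa using h
  have h1 := integrableOn_laplace_directional hBc₁ hBg₁ w (by simpa using hw)
  refine h1.congr_fun (fun s _ => ?_) measurableSet_Ioi
  simp only [mul_one]

/-- **The horizontal ray from the corner.**  `B` continuous on the half-strip `{Re τ > 0, |Im τ| < η}` with `‖B τ‖ ≤ A·e^{c·Re τ}` there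
(`c ≥ 0`); a corner `b` with `0 < Re b ≤ η`, `|Im b| < η`; `Re w > c`.  Then `s ↦ e^{−(b+s)w}B(b+s)` is integrable on `(0,∞)` and
`‖∫₀^∞ e^{−(b+s)w}B(b+s)ds‖ ≤ A·e^{cη}·e^{−Re(bw)}∕(Re w − c)` (majorant `A e^{cη}e^{−Re(bw)}·e^{−(Re w − c)s}`). [folklore] -/
theorem hray_estimate {B : ℂ → ℂ} {η A c : ℝ} {b w : ℂ} (hc : 0 ≤ c) (hA : 0 ≤ A)
    (hBc : ContinuousOn B {τ : ℂ | 0 < τ.re ∧ |τ.im| < η})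
    (hBg : ∀ τ : ℂ, 0 < τ.re → |τ.im| < η → ‖B τ‖ ≤ A * Real.exp (c * τ.re))
    (hbre : 0 < b.re) (hbη : b.re ≤ η) (hbim : |b.im| < η) (hw : c < w.re) :
    IntegrableOn (fun s : ℝ => cexp (-((b + s) * w)) * B (b + s)) (Ioi 0) ∧
    ‖∫ s in Ioi (0 : ℝ), cexp (-((b + s) * w)) * B (b + s)‖ ≤
      A * Real.exp (c * η) * Real.exp (-(b * w).re) / (w.re - c) := by
  set lam : ℝ := w.re - c with hlam
  have hlam0 : 0 < lam := by rw [hlam]; linarith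
  set K₀ : ℝ := A * Real.exp (c * η) * Real.exp (-(b * w).re) with hK₀
  have hmem : ∀ s : ℝ, 0 < s → 0 < (b + (s : ℂ)).re ∧ |(b + (s : ℂ)).im| < η := by
    intro s hs
    refine ⟨?_, ?_⟩
    · rw [Complex.add_re, Complex.ofReal_re]; linarith
    · rw [Complex.add_im, Complex.ofReal_im, add_zero]; exact hbim
  have hcont : ContinuousOn (fun s : ℝ => cexp (-((b + s) * w)) * B (b + s)) (Ioi 0) :=
    (by fun_prop : Continuous fun s : ℝ => cexp (-((b + (s : ℂ)) * w))).continuousOn.mul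
      (hBc.comp (by fun_prop : Continuous fun s : ℝ => b + (s : ℂ)).continuousOn fun s hs => hmem s hs)
  have hmaj : ∀ s ∈ Ioi (0 : ℝ), ‖cexp (-((b + s) * w)) * B (b + s)‖ ≤ K₀ * Real.exp (-lam * s) := by
    intro s hs
    have hs : 0 < s := hs
    have hre : (-((b + (s : ℂ)) * w)).re = -(b * w).re - s * w.re := by
      rw [Complex.neg_re, add_mul, Complex.add_re, Complex.re_ofReal_mul]; ring
    have hre2 : (b + (s : ℂ)).re = b.re + s := by rw [Complex.add_re, Complex.ofReal_re]
    have hB : ‖B (b + s)‖ ≤ A * Real.exp (c * η + c * s) := by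
      have h := hBg (b + s) (hmem s hs).1 (hmem s hs).2
      rw [hre2] at h
      refine h.trans ?_
      gcongr
      nlinarith
    rw [norm_mul, Complex.norm_exp, hre]
    calc Real.exp (-(b * w).re - s * w.re) * ‖B (b + s)‖
        ≤ Real.exp (-(b * w).re - s * w.re) * (A * Real.exp (c * η + c * s)) :=
          mul_le_mul_of_nonneg_left hB (Real.exp_pos _).le
      _ = A * (Real.exp (-(b * w).re - s * w.re) * Real.exp (c * η + c * s)) := by ring
      _ = K₀ * Real.exp (-lam * s) := by
          rw [hK₀, hlam, mul_assoc A, mul_assoc A, ← Real.exp_add, ← Real.exp_add, ← Real.exp_add]; congr 2; ring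
  have hmi : IntegrableOn (fun s : ℝ => K₀ * Real.exp (-lam * s)) (Ioi 0) :=
    (exp_neg_integrableOn_Ioi 0 hlam0).const_mul K₀
  have hI : IntegrableOn (fun s : ℝ => cexp (-((b + s) * w)) * B (b + s)) (Ioi 0) :=
    Integrable.mono' hmi (hcont.aestronglyMeasurable measurableSet_Ioi)
      ((ae_restrict_iff' measurableSet_Ioi).mpr (Eventually.of_forall hmaj))
  refine ⟨hI, ?_⟩
  calc ‖∫ s in Ioi (0 : ℝ), cexp (-((b + s) * w)) * B (b + s)‖
      ≤ ∫ s in Ioi (0 : ℝ), K₀ * Real.exp (-lam * s) :=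
        norm_integral_le_of_norm_le hmi ((ae_restrict_iff' measurableSet_Ioi).mpr (Eventually.of_forall hmaj))
    _ = K₀ / lam := by
        rw [integral_const_mul, integral_exp_mul_Ioi (neg_lt_zero.mpr hlam0) 0, mul_zero, Real.exp_zero, neg_div_neg_eq,
          mul_one_div]

/-! ## §4 The path move: `∫₀^∞ e^{−tw}B = ∫_{[0,b]} + ∫_{b + ℝ₊}` -/

/-- **THE PATH `γ_b`.**  `B` holomorphic on `ball 0 R₀ ∪ {Re τ > 0, |Im τ| < η}` (`0 < η < R₀`) with `‖B τ‖ ≤ A·e^{c·Re τ}` on the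
half-strip (`c ≥ 0`); `ε = ±1`, `d = d_ε`, `b = η·d`; `Re w > c` and `Re(b·w) ≥ 0`.  Then
`∫₀^∞ e^{−tw}B(t)dt = ∫₀^η e^{−s(dw)}B(sd)·d ds + ∫₀^∞ e^{−(b+s)w}B(b+s) ds`
(37a in the convex region `U′`; the far connector `[R, b+R]` carries `‖e^{−ζw}B ζ‖ ≤ A e^{cη}e^{−(Re w − c)R}`).
[cite: LodayRichaud2016, Thm 5.3.9 (i)⇒(ii), path γ_b] -/
theorem laplace_eq_segment_add_hray {B : ℂ → ℂ} {R₀ η A c ε : ℝ} {d b w : ℂ} (hη : 0 < η) (hηR : η < R₀) (hc : 0 ≤ c)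
    (hA : 0 ≤ A) (hε : ε = 1 ∨ ε = -1) (hd : d = ((3 : ℂ) - 4 * (ε : ℂ) * I) / 5) (hb : b = (η : ℂ) * d)
    (hBd : DifferentiableOn ℂ B (ball (0 : ℂ) R₀ ∪ {τ : ℂ | 0 < τ.re ∧ |τ.im| < η}))
    (hBg : ∀ τ : ℂ, 0 < τ.re → |τ.im| < η → ‖B τ‖ ≤ A * Real.exp (c * τ.re))
    (hw : c < w.re) (hbw : 0 ≤ (b * w).re) :
    ∫ t in Ioi (0 : ℝ), cexp (-(t : ℂ) * w) * B t =
      (∫ s in (0 : ℝ)..η, cexp (-(s : ℂ) * (d * w)) * (B ((s : ℂ) * d) * d)) +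
        ∫ s in Ioi (0 : ℝ), cexp (-((b + s) * w)) * B (b + s) := by
  have hbre : b.re = 3 * η / 5 := by rw [hb, hd]; exact corner_re ε η
  have hbim : |b.im| = 4 * η / 5 := by rw [hb, hd]; exact abs_corner_im hε hη.le
  set ST : Set ℂ := {τ : ℂ | 0 < τ.re ∧ |τ.im| < η} with hST
  set U' : Set ℂ := {ζ : ℂ | -(R₀ / 10) < ζ.re ∧ |ζ.im| < 9 * η / 10} with hU'
  have hU'sub : U' ⊆ ball (0 : ℂ) R₀ ∪ ST := region_subset hηR
  set h : ℂ → ℂ := fun ζ => cexp (-(ζ * w)) * B ζ with hh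
  have hhd : DifferentiableOn ℂ h U' :=
    ((differentiable_id.mul_const w).neg.cexp.differentiableOn).mul (hBd.mono hU'sub)
  have hray₁ : ∀ s : ℝ, 0 ≤ s → (s : ℂ) ∈ U' := by
    intro s hs
    refine ⟨?_, ?_⟩
    · rw [Complex.ofReal_re]; linarith
    · rw [Complex.ofReal_im, abs_zero]; positivity
  have hray₂ : ∀ s : ℝ, 0 ≤ s → b + (s : ℂ) ∈ U' := by
    intro s hs
    refine ⟨?_, ?_⟩
    · rw [Complex.add_re, Complex.ofReal_re, hbre]; linarith
    · rw [Complex.add_im, Complex.ofReal_im, add_zero, hbim]; linarith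
  have hBcST : ContinuousOn B ST := (hBd.mono subset_union_right).continuousOn
  have hint₁ : IntegrableOn (fun s : ℝ => h s) (Ioi 0) := by
    have h1 := integrableOn_laplace_real hη hBcST hBg hw
    refine h1.congr_fun (fun s _ => ?_) measurableSet_Ioi
    simp only [hh, neg_mul]
  have h3 := hray_estimate (w := w) hc hA hBcST hBg (by rw [hbre]; positivity) (by rw [hbre]; linarith)
    (by rw [hbim]; linarith) hw
  have hint₂ : IntegrableOn (fun s : ℝ => h (b + s)) (Ioi 0) := h3.1
  -- the far connector
  have hdecay : ∀ R : ℝ, 1 ≤ R → ∀ σ : ℝ, σ ∈ Icc (0 : ℝ) 1 →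
      ‖h ((R : ℂ) + (σ : ℂ) * b)‖ ≤ A * Real.exp (c * η) * Real.exp (-((w.re - c) * R)) := by
    intro R hR σ hσ
    have hζre : ((R : ℂ) + (σ : ℂ) * b).re = R + σ * (3 * η / 5) := by
      rw [Complex.add_re, Complex.ofReal_re, Complex.re_ofReal_mul, hbre]
    have hζim : |((R : ℂ) + (σ : ℂ) * b).im| ≤ 4 * η / 5 := by
      rw [Complex.add_im, Complex.ofReal_im, Complex.im_ofReal_mul, zero_add, abs_mul, abs_of_nonneg hσ.1, hbim]
      nlinarith [hσ.2, hη]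
    have hBζ := hBg ((R : ℂ) + (σ : ℂ) * b) (by rw [hζre]; nlinarith [hσ.1]) (hζim.trans_lt (by linarith))
    rw [hζre] at hBζ
    have hexpre : (-(((R : ℂ) + (σ : ℂ) * b) * w)).re = -(R * w.re) - σ * (b * w).re := by
      rw [Complex.neg_re, add_mul, Complex.add_re, Complex.re_ofReal_mul, mul_assoc, Complex.re_ofReal_mul]; ring
    simp only [hh]
    rw [norm_mul, Complex.norm_exp, hexpre]
    have h1 : Real.exp (-(R * w.re) - σ * (b * w).re) ≤ Real.exp (-(R * w.re)) :=
      Real.exp_le_exp.mpr (by nlinarith [hσ.1])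
    have h2 : A * Real.exp (c * (R + σ * (3 * η / 5))) ≤ A * Real.exp (c * η + c * R) := by
      gcongr
      nlinarith [mul_nonneg hc (mul_nonneg hη.le (sub_nonneg.mpr hσ.2)), mul_nonneg (mul_nonneg hc hη.le) hσ.1]
    have h4 : Real.exp (-(R * w.re)) * Real.exp (c * R) = Real.exp (-((w.re - c) * R)) := by
      rw [← Real.exp_add]; congr 1; ring
    calc Real.exp (-(R * w.re) - σ * (b * w).re) * ‖B ((R : ℂ) + (σ : ℂ) * b)‖
        ≤ Real.exp (-(R * w.re)) * (A * Real.exp (c * η + c * R)) :=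
          mul_le_mul h1 (hBζ.trans h2) (norm_nonneg _) (Real.exp_pos _).le
      _ = A * Real.exp (c * η) * (Real.exp (-(R * w.re)) * Real.exp (c * R)) := by rw [Real.exp_add]; ring
      _ = A * Real.exp (c * η) * Real.exp (-((w.re - c) * R)) := by rw [h4]
  have key := integral_Ioi_sub_integral_Ioi_shift (isOpen_region R₀ η) (convex_region R₀ η) hhd hray₁ hray₂ hint₁ hint₂
    (by linarith : 0 < w.re - c) hdecay
  -- reshape
  have e1 : ∫ t in Ioi (0 : ℝ), cexp (-(t : ℂ) * w) * B t = ∫ s in Ioi (0 : ℝ), h s := by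
    refine setIntegral_congr_fun measurableSet_Ioi fun t _ => ?_
    simp only [hh, neg_mul]
  have e2 : ∫ σ in (0 : ℝ)..1, h ((σ : ℂ) * b) * b =
      ∫ s in (0 : ℝ)..η, cexp (-(s : ℂ) * (d * w)) * (B ((s : ℂ) * d) * d) := by
    rw [hb, segment_rescale h d η]
    refine intervalIntegral.integral_congr fun s _ => ?_
    simp only [hh]
    rw [show -((s : ℂ) * d * w) = -(s : ℂ) * (d * w) by ring]; ring
  rw [e1, ← e2, ← key]
  simp only [hh]
  ring

end

end Summit.QuantumFields.BalabanUV.Beta.EriceFlowEnclosureBorelPathMove
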